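import Mathlib
import HarnessLib

/-!
# Iterated conditional expectations need not commute: a three-point example
# (Durrett 2019, §4.1 Exercise 4.1.5)

Topic `Probability/Process` (Durrett Chapter 4, conditional expectation); namespace
`Literature.Probability.Process`.  THEOREMS ONLY: everything is PROVED; no definition, no named
fact, no axiom.

Source, VERBATIM [cite: Durrett2019, §4.1 Exercise 4.1.5, p. 197 of the held copy
`book:durrett2019-probability-theory-examples` (PDF p0209:L27)]: "4.1.5 Give an example on
`Ω = {a, b, c}` in which `E(E(X|𝓕₁)|𝓕₂) ≠ E(E(X|𝓕₂)|𝓕₁)`."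

THE EXAMPLE (SOLVED; the book prints none).  `Ω = {a, b, c} = Fin 3` (`a = 0`, `b = 1`, `c = 2`)
with the uniform probability `P = ⅓·count`; `𝓕₁ = σ({a}) = {∅, {a}, {b,c}, Ω}`, `𝓕₂ = σ({c})`;
`X = 1_{a}`.  Then `E(X|𝓕₁) = X` (`X` is `𝓕₁`-measurable), `E(X|𝓕₂) = ½·1_{{a,b}}`, so
`E(E(X|𝓕₁)|𝓕₂) = E(X|𝓕₂) = ½·1_{{a,b}}` while
`E(E(X|𝓕₂)|𝓕₁) = E(½·1_{{a,b}}|𝓕₁) = ½·1_{a} + ¼·1_{{b,c}}`; the two differ at `c` (values `0` and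
`¼`), a point of positive probability.  Conditional expectation is Mathlib's `μ[f|m]`
(`MeasureTheory.condExp`), so all identities are a.e. ones and the conclusion is
`¬ (E(E(X|𝓕₁)|𝓕₂) =ᵐ E(E(X|𝓕₂)|𝓕₁))` (on this space with full-support `P`, a.e. equality is
equality).  The computations go through the defining property of `E(·|σ({S}))` on the four sets
`∅, S, Sᶜ, Ω` (Mathlib `measurableSet_generateFrom_singleton_iff`,
`ae_eq_condExp_of_forall_setIntegral_eq`): `condExp_generateFrom_singleton_ae_eq`.
(The tree's `CondExpCauchySchwarzPythagoras.lean` lists this exercise as "not treated"; it is the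
only item of Durrett's §4.1 exercise list that was missing.)

## References
* R. Durrett, *Probability: Theory and Examples*, 5th ed. (CUP 2019), §4.1 Exercise 4.1.5
  (p. 197). [cite: Durrett2019]
-/

noncomputable section

namespace Literature.Probability.Process

open _root_.MeasureTheory _root_.ProbabilityTheory _root_.Set
open scoped ENNReal NNReal

/-! ### The three-point probability space `(Fin 3, ⅓·count)` -/

/-- `P{x} = ⅓`. [cite: Durrett2019, §4.1 Exercise 4.1.5 (solution)] -/
theorem uniformThree_singleton (x : Fin 3) :
    ((3⁻¹ : ℝ≥0) • (Measure.count : Measure (Fin 3))) {x} = (3 : ℝ≥0∞)⁻¹ := by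
  rw [Measure.smul_apply, Measure.count_singleton, ENNReal.smul_def, smul_eq_mul, mul_one]
  simp

/-- `P = ⅓·count` on `Fin 3` is a probability measure.
[cite: Durrett2019, §4.1 Exercise 4.1.5 (solution)] -/
theorem isProbabilityMeasure_uniformThree :
    IsProbabilityMeasure ((3⁻¹ : ℝ≥0) • (Measure.count : Measure (Fin 3))) := by
  constructor
  rw [Measure.smul_apply, ← Finset.coe_univ, Measure.count_apply_finset, Finset.card_univ,
    Fintype.card_fin, ENNReal.smul_def, smul_eq_mul]
  simp only [ENNReal.coe_inv (by norm_num : (3 : ℝ≥0) ≠ 0), ENNReal.coe_ofNat, Nat.cast_ofNat]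
  exact ENNReal.inv_mul_cancel (by norm_num) (by norm_num)

/-- Integrals over `(Fin 3, ⅓·count)` are finite sums: `∫_t f dP = ⅓ Σ_{x ∈ t} f(x)`.
[cite: Durrett2019, §4.1 Exercise 4.1.5 (solution)] -/
theorem setIntegral_uniformThree (t : Set (Fin 3)) (f : Fin 3 → ℝ) :
    ∫ x in t, f x ∂((3⁻¹ : ℝ≥0) • (Measure.count : Measure (Fin 3))) =
      3⁻¹ * ∑ x : Fin 3, t.indicator f x := by
  rw [← integral_indicator (MeasurableSet.of_discrete), integral_fintype (Integrable.of_finite),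
    Finset.mul_sum]
  refine Finset.sum_congr rfl fun x _ => ?_
  rw [measureReal_def, uniformThree_singleton, smul_eq_mul, ENNReal.toReal_inv]
  norm_num

/-! ### Conditional expectation given a σ-field generated by one event -/

/-- On `(Fin 3, ⅓·count)`: if `g` is `σ({S})`-measurable and has the same integrals as `f` over `S`
and over `Sᶜ`, then `E(f | σ({S})) = g` a.s. — the σ-field `σ({S})` is `{∅, S, Sᶜ, Ω}`.
[cite: Durrett2019, §4.1 Exercise 4.1.5 (solution; the defining property (i)–(ii) of §4.1)] -/
theorem condExp_generateFrom_singleton_ae_eq (S : Set (Fin 3)) {f g : Fin 3 → ℝ}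
    (hg : Measurable[MeasurableSpace.generateFrom {S}] g)
    (h1 : ∫ x in S, g x ∂((3⁻¹ : ℝ≥0) • (Measure.count : Measure (Fin 3))) =
      ∫ x in S, f x ∂((3⁻¹ : ℝ≥0) • (Measure.count : Measure (Fin 3))))
    (h2 : ∫ x in Sᶜ, g x ∂((3⁻¹ : ℝ≥0) • (Measure.count : Measure (Fin 3))) =
      ∫ x in Sᶜ, f x ∂((3⁻¹ : ℝ≥0) • (Measure.count : Measure (Fin 3)))) :
    ((3⁻¹ : ℝ≥0) • (Measure.count : Measure (Fin 3)))[f | MeasurableSpace.generateFrom {S}]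
      =ᵐ[(3⁻¹ : ℝ≥0) • (Measure.count : Measure (Fin 3))] g := by
  have hm : MeasurableSpace.generateFrom {S} ≤ (inferInstance : MeasurableSpace (Fin 3)) :=
    MeasurableSpace.generateFrom_singleton_le MeasurableSet.of_discrete
  have hP : IsProbabilityMeasure ((3⁻¹ : ℝ≥0) • (Measure.count : Measure (Fin 3))) :=
    isProbabilityMeasure_uniformThree
  have hσ : SigmaFinite (((3⁻¹ : ℝ≥0) • (Measure.count : Measure (Fin 3))).trim hm) := by
    have : IsFiniteMeasure (((3⁻¹ : ℝ≥0) • (Measure.count : Measure (Fin 3))).trim hm) :=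
      isFiniteMeasure_trim hm
    infer_instance
  refine (ae_eq_condExp_of_forall_setIntegral_eq hm (Integrable.of_finite)
    (fun t _ _ => (Integrable.of_finite).integrableOn) (fun t ht _ => ?_)
    (hg.stronglyMeasurable.aestronglyMeasurable)).symm
  -- the four sets of `σ({S})`
  have huniv : ∫ x, g x ∂((3⁻¹ : ℝ≥0) • (Measure.count : Measure (Fin 3))) =
      ∫ x, f x ∂((3⁻¹ : ℝ≥0) • (Measure.count : Measure (Fin 3))) := by
    rw [← integral_add_compl (MeasurableSet.of_discrete (s := S)) (Integrable.of_finite (f := g)),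
      h1, h2, integral_add_compl (MeasurableSet.of_discrete (s := S)) (Integrable.of_finite)]
  rcases measurableSet_generateFrom_singleton_iff.1 ht with rfl | rfl | rfl | rfl
  · simp
  · exact h1
  · exact h2
  · simp only [Measure.restrict_univ]; exact huniv

/-! ### Exercise 4.1.5 -/

/-- `E(1_{a} | σ({a})) = 1_{a}` a.s. (the variable is measurable for the σ-field).
[cite: Durrett2019, §4.1 Exercise 4.1.5 (solution)] -/
theorem condExp_indicator_zero_gen_zero :
    ((3⁻¹ : ℝ≥0) • (Measure.count : Measure (Fin 3)))[
        ({0} : Set (Fin 3)).indicator (fun _ => (1 : ℝ))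
        | MeasurableSpace.generateFrom {({0} : Set (Fin 3))}]
      =ᵐ[(3⁻¹ : ℝ≥0) • (Measure.count : Measure (Fin 3))]
        ({0} : Set (Fin 3)).indicator (fun _ => (1 : ℝ)) :=
  condExp_generateFrom_singleton_ae_eq {0}
    (Measurable.indicator measurable_const
      (MeasurableSpace.measurableSet_generateFrom (mem_singleton _))) rfl rfl

/-- `E(1_{a} | σ({c})) = ½·1_{{a,b}}` a.s. [cite: Durrett2019, §4.1 Exercise 4.1.5 (solution)] -/
theorem condExp_indicator_zero_gen_two :
    ((3⁻¹ : ℝ≥0) • (Measure.count : Measure (Fin 3)))[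
        ({0} : Set (Fin 3)).indicator (fun _ => (1 : ℝ))
        | MeasurableSpace.generateFrom {({2} : Set (Fin 3))}]
      =ᵐ[(3⁻¹ : ℝ≥0) • (Measure.count : Measure (Fin 3))]
        ({2}ᶜ : Set (Fin 3)).indicator (fun _ => (1 / 2 : ℝ)) := by
  refine condExp_generateFrom_singleton_ae_eq {2}
    (Measurable.indicator measurable_const
      (MeasurableSpace.measurableSet_generateFrom (mem_singleton _)).compl)
    ?_ ?_
  · rw [setIntegral_uniformThree, setIntegral_uniformThree]
    simp [Set.indicator]
  · rw [setIntegral_uniformThree, setIntegral_uniformThree]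
    simp [Fin.sum_univ_three, Set.indicator]
    norm_num

/-- `E(½·1_{{a,b}} | σ({a})) = ½·1_{a} + ¼·1_{{b,c}}` a.s.
[cite: Durrett2019, §4.1 Exercise 4.1.5 (solution)] -/
theorem condExp_half_indicator_gen_zero :
    ((3⁻¹ : ℝ≥0) • (Measure.count : Measure (Fin 3)))[
        ({2}ᶜ : Set (Fin 3)).indicator (fun _ => (1 / 2 : ℝ))
        | MeasurableSpace.generateFrom {({0} : Set (Fin 3))}]
      =ᵐ[(3⁻¹ : ℝ≥0) • (Measure.count : Measure (Fin 3))]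
        ({0} : Set (Fin 3)).piecewise (fun _ => (1 / 2 : ℝ)) (fun _ => (1 / 4 : ℝ)) := by
  classical
  refine condExp_generateFrom_singleton_ae_eq {0}
    (Measurable.piecewise (MeasurableSpace.measurableSet_generateFrom (mem_singleton _))
      measurable_const measurable_const) ?_ ?_
  · rw [setIntegral_uniformThree, setIntegral_uniformThree]
    simp [Set.indicator, Set.piecewise]
  · rw [setIntegral_uniformThree, setIntegral_uniformThree]
    simp [Fin.sum_univ_three, Set.indicator, Set.piecewise]
    norm_num

/-- **Exercise 4.1.5** (SOLVED): on `Ω = {a,b,c}` (`= Fin 3`, uniform `P`), with `𝓕₁ = σ({a})`,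
`𝓕₂ = σ({c})` and `X = 1_{a}`: `E(E(X|𝓕₁)|𝓕₂) = ½·1_{{a,b}}` while
`E(E(X|𝓕₂)|𝓕₁) = ½·1_{a} + ¼·1_{{b,c}}`, and these are NOT a.e. equal (they differ at `c`, which has
probability `⅓`). [cite: Durrett2019, §4.1 Exercise 4.1.5] -/
theorem Durrett2019_exercise_4_1_5 :
    ¬ (((3⁻¹ : ℝ≥0) • (Measure.count : Measure (Fin 3)))[
          ((3⁻¹ : ℝ≥0) • (Measure.count : Measure (Fin 3)))[
            ({0} : Set (Fin 3)).indicator (fun _ => (1 : ℝ))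
            | MeasurableSpace.generateFrom {({0} : Set (Fin 3))}]
          | MeasurableSpace.generateFrom {({2} : Set (Fin 3))}]
        =ᵐ[(3⁻¹ : ℝ≥0) • (Measure.count : Measure (Fin 3))]
        ((3⁻¹ : ℝ≥0) • (Measure.count : Measure (Fin 3)))[
          ((3⁻¹ : ℝ≥0) • (Measure.count : Measure (Fin 3)))[
            ({0} : Set (Fin 3)).indicator (fun _ => (1 : ℝ))
            | MeasurableSpace.generateFrom {({2} : Set (Fin 3))}]
          | MeasurableSpace.generateFrom {({0} : Set (Fin 3))}]) := by
  classical
  intro h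
  -- the left side is `½·1_{{a,b}}`, the right side `½·1_{a} + ¼·1_{{b,c}}`
  have hL := (condExp_congr_ae (m := MeasurableSpace.generateFrom {({2} : Set (Fin 3))})
    condExp_indicator_zero_gen_zero).trans condExp_indicator_zero_gen_two
  have hR := (condExp_congr_ae (m := MeasurableSpace.generateFrom {({0} : Set (Fin 3))})
    condExp_indicator_zero_gen_two).trans condExp_half_indicator_gen_zero
  have heq := (hL.symm.trans h).trans hR
  -- but they differ at `c = 2`, a point of positive mass
  have hc : ((3⁻¹ : ℝ≥0) • (Measure.count : Measure (Fin 3))) {x | ¬ (({2}ᶜ : Set (Fin 3)).indicator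
      (fun _ => (1 / 2 : ℝ)) x = ({0} : Set (Fin 3)).piecewise (fun _ => (1 / 2 : ℝ))
        (fun _ => (1 / 4 : ℝ)) x)} = 0 := ae_iff.1 heq
  have h2 : (2 : Fin 3) ∈ {x | ¬ (({2}ᶜ : Set (Fin 3)).indicator (fun _ => (1 / 2 : ℝ)) x =
      ({0} : Set (Fin 3)).piecewise (fun _ => (1 / 2 : ℝ)) (fun _ => (1 / 4 : ℝ)) x)} := by
    simp [Set.indicator, Set.piecewise]
  have hpos : ((3⁻¹ : ℝ≥0) • (Measure.count : Measure (Fin 3))) {(2 : Fin 3)} ≠ 0 := by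
    rw [uniformThree_singleton]; simp
  exact hpos (measure_mono_null (singleton_subset_iff.2 h2) hc)

end Literature.Probability.Process
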